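import Mathlib
import HarnessLib
import Literature.Analysis.FluidPDE.ClassicalSolution
import Literature.Analysis.FluidPDE.LerayHopf
import Literature.Analysis.FluidPDE.SuitableWeak
import Summits.NavierStokesRegularity.NavierStokesRegularity.Theorems.QuarterJoltL4SliceTestCriterion
import Summits.NavierStokesRegularity.NavierStokesRegularity.Theorems.QuarterJoltWeakL4EnergyEquality
import Summits.NavierStokesRegularity.NavierStokesRegularity.Theorems.QuarterJoltEnstrophyRateEnergyEquality
import Summits.NavierStokesRegularity.NavierStokesRegularity.Theorems.QuarterJoltTypeIEnergyEquality

/-!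
# Route QuarterJolt — crux `NoTerminalJolt` (stmt-NavierStokesRegularity-26463), LEAD line
# `regular_split` rev 8: THE ENSTROPHY–`L⁴` TRADE-OFF LAW and WHERE STUB 3 LIVES (summary)

Seat ns-ntj-p1 g6 (LEAD of the crux; `--supports 26463 --as helper`). Frame: `(u,p)` classical on
`[0,T)` (`ν, T > 0`), Leray–Hopf on `[0,T]` from a rapidly decaying datum; `Z(t) = ∫|Du(t)|²_F`.

1. `tendsto_integral_norm_sub_sq_of_enstrophyRate_of_l4Tail` — THE TRADE-OFF LAW: an enstrophy rate
   `Z(t) ≤ M(T−t)^{−α}` with `α < 1` together with an `L⁴` tail `∫ₜᵀ‖u‖²_{L⁴} ≤ C(T−t)^β` with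
   `β > α/2`, both for `t < T` near `T`, force `∫‖u(t) − u(T)‖² → 0` (master form of the `L⁴`
   slice-test criterion, p652789: the bound is `(ν/2)M(T−t)^{1−α} + 2√M·C·(T−t)^{β−α/2} → 0`). By
   Ladyzhenskaya `β = 1 − 3α/4` comes for free, and `1 − 3α/4 > α/2 ⟺ α < 4/5` is rev 5's enstrophy
   theorem (p641804); for ENSTROPHY-HEAVY blow-ups (`4/5 ≤ α < 1`) the energy equality still holds as
   soon as the `L⁴` tail beats the self-similar-free exponent `α/2`; `β ≥ 1/2` needs no rate at all
   (the criterion itself).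
2. `typeIIEnergyEquality_iff_allHeavy` — SUMMARY POSITION for the skeleton: the former stub 3 (⟺
   `stub_noFastEnergyConcentration` = stmt-18118) is equivalent to itself restricted to first blow-ups
   which are simultaneously NOT sup-norm Type I, ENSTROPHY-HEAVY (no rate `M(T−t)^{−α}`, `α < 4/5`)
   and `L⁴`-HEAVY (no rate `∫‖u(t)‖⁴ ≤ M/(T−t)`) — the intersection of the rev-5 and rev-8 positions.

HONEST FRAMING: conditional criteria and bookkeeping; nothing here claims progress on
`NoTerminalJolt`, stmt-18118 or Navier–Stokes regularity — all OPEN. No summit statement is proved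
here. [folklore]
-/

noncomputable section

-- the summit and its single sub-problem share the name (CONVENTIONS §1), as in every Theorems file
set_option linter.dupNamespace false

namespace Summit.NavierStokesRegularity.NavierStokesRegularity.Theorems

open MeasureTheory Set Function Filter Topology InnerProductSpace
open scoped ENNReal NNReal ContDiff RealInnerProductSpace
open Literature.Analysis.FluidPDE

namespace NoTerminalJolt

/-! ### The enstrophy–`L⁴` trade-off law -/

/-- **THE ENSTROPHY–`L⁴` TRADE-OFF LAW.** `(u,p)` classical on `[0,T)` (`ν, T > 0`), Leray–Hopf on
`[0,T]` from a rapidly decaying datum. Suppose, for `t < T` near `T`, an enstrophy rate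
`∫|Du(t)|²_F ≤ M(T−t)^{−α}` (`M ≥ 0`, `α < 1`) and an `L⁴` tail bound
`∫⁻_{(t,T)} ofReal ‖u(τ)‖²_{L⁴} dτ ≤ ofReal (C(T−t)^β)` (`C ≥ 0`) with `β > α/2`. Then
`∫‖u(t) − u(T)‖² → 0` as `t ↑ T` (no energy jump ⟺ Leray's energy equality on `[0,T]`). Proof: the
right-hand side of the `L⁴` terminal approach law is `≤ (ν/2)M(T−t)^{1−α} + 2√M C (T−t)^{β−α/2} → 0`;
master form `tendsto_integral_norm_sub_sq_of_frequently_l4Bound_lt`. Rev 5's enstrophy theorem is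
`β = 1 − 3α/4` (Ladyzhenskaya), `α < 4/5`; the criterion of rev 8 is `β = 1/2`, any `α < 1`. [folklore] -/
theorem tendsto_integral_norm_sub_sq_of_enstrophyRate_of_l4Tail {ν T : ℝ} (hν : 0 < ν) (hT : 0 < T)
    {u : ℝ → EuclideanSpace ℝ (Fin 3) → EuclideanSpace ℝ (Fin 3)} {p : ℝ → EuclideanSpace ℝ (Fin 3) → ℝ}
    (hcl : IsClassicalNSSolutionOn (Ico 0 T) ν 0 u p) (hLH : IsLerayHopfOn T ν 0 (u 0) u)
    (hdec : HasRapidSpatialDecay (u 0)) {M α C β : ℝ} (hM : 0 ≤ M) (hα : α < 1) (hC : 0 ≤ C)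
    (hβ : α / 2 < β)
    (hZ : ∀ᶠ t in 𝓝[<] T, ∫ x, frobeniusNormSq (fderiv ℝ (u t) x) ≤ M * (T - t) ^ (-α))
    (htail : ∀ᶠ t in 𝓝[<] T, ∫⁻ τ in Ioo t T, ENNReal.ofReal (Real.sqrt (∫ x, ‖u τ x‖ ^ 4)) ≤
      ENNReal.ofReal (C * (T - t) ^ β)) :
    Tendsto (fun t => ∫ x, ‖u t x - u T x‖ ^ 2) (𝓝[<] T) (𝓝 0) := by
  refine tendsto_integral_norm_sub_sq_of_frequently_l4Bound_lt hν hT hcl hLH hdec fun δ hδ => ?_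
  -- the explicit majorant of the approach-law bound tends to `0`
  set F : ℝ → ℝ := fun t => ν / 2 * (M * (T - t) ^ (1 - α)) +
    2 * (Real.sqrt M * C * (T - t) ^ (β - α / 2)) with hF
  have hsub : Tendsto (fun t : ℝ => T - t) (𝓝[<] T) (𝓝 0) := by
    have h : Tendsto (fun t : ℝ => T - t) (𝓝 T) (𝓝 (T - T)) := tendsto_const_nhds.sub tendsto_id
    rw [sub_self] at h
    exact tendsto_nhdsWithin_of_tendsto_nhds h
  have hpow : ∀ γ : ℝ, 0 < γ → Tendsto (fun t : ℝ => (T - t) ^ γ) (𝓝[<] T) (𝓝 0) := by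
    intro γ hγ
    have h := hsub.rpow_const (p := γ) (Or.inr hγ.le)
    rwa [Real.zero_rpow hγ.ne'] at h
  have hFlim : Tendsto F (𝓝[<] T) (𝓝 0) := by
    have h1 := ((hpow (1 - α) (by linarith)).const_mul M).const_mul (ν / 2)
    have h2 := ((hpow (β - α / 2) (by linarith)).const_mul (Real.sqrt M * C)).const_mul 2
    simp only [mul_zero] at h1 h2
    have := h1.add h2
    simpa only [add_zero, hF] using this
  have hFev : ∀ᶠ t in 𝓝[<] T, F t < δ := hFlim.eventually (gt_mem_nhds hδ)
  have hwin : ∀ᶠ t in 𝓝[<] T, t ∈ Ioo 0 T := Ioo_mem_nhdsLT hT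
  refine ((hZ.and (htail.and (hFev.and hwin))).frequently).mono fun t ⟨hZt, hct, hFt, htI⟩ => ?_
  have hTt : 0 < T - t := sub_pos.2 htI.2
  set Z : ℝ := ∫ x, frobeniusNormSq (fderiv ℝ (u t) x) with hZdef
  set L : ℝ≥0∞ := ∫⁻ τ in Ioo t T, ENNReal.ofReal (Real.sqrt (∫ x, ‖u τ x‖ ^ 4)) with hL
  have hZ0 : 0 ≤ Z := integral_nonneg fun x => frobeniusNormSq_nonneg _
  have hLfin : L ≠ ⊤ := ne_top_of_le_ne_top ENNReal.ofReal_ne_top hct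
  have hLle : L.toReal ≤ C * (T - t) ^ β := by
    have := (ENNReal.toReal_le_toReal hLfin ENNReal.ofReal_ne_top).2 hct
    rwa [ENNReal.toReal_ofReal (by positivity)] at this
  refine ⟨hLfin, lt_of_le_of_lt ?_ hFt⟩
  -- first term
  have h1 : ν / 2 * ((T - t) * Z) ≤ ν / 2 * (M * (T - t) ^ (1 - α)) := by
    refine mul_le_mul_of_nonneg_left ?_ (by positivity)
    have e : (T - t) * (M * (T - t) ^ (-α)) = M * (T - t) ^ (1 - α) := by
      rw [show (1 : ℝ) - α = 1 + -α by ring, Real.rpow_add hTt, Real.rpow_one]; ring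
    calc (T - t) * Z ≤ (T - t) * (M * (T - t) ^ (-α)) := mul_le_mul_of_nonneg_left hZt hTt.le
      _ = M * (T - t) ^ (1 - α) := e
  -- second term: `√Z ≤ √M (T−t)^{−α/2}`
  have hsqrt : Real.sqrt Z ≤ Real.sqrt M * (T - t) ^ (-(α / 2)) := by
    have h := Real.sqrt_le_sqrt hZt
    rw [Real.sqrt_mul hM, Real.sqrt_eq_rpow ((T - t) ^ (-α)), ← Real.rpow_mul hTt.le] at h
    have e : -α * (1 / 2 : ℝ) = -(α / 2) := by ring
    rwa [e] at h
  have h2 : Real.sqrt Z * L.toReal ≤ Real.sqrt M * C * (T - t) ^ (β - α / 2) := by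
    calc Real.sqrt Z * L.toReal ≤ (Real.sqrt M * (T - t) ^ (-(α / 2))) * (C * (T - t) ^ β) :=
          mul_le_mul hsqrt hLle ENNReal.toReal_nonneg (by positivity)
      _ = Real.sqrt M * C * ((T - t) ^ (-(α / 2)) * (T - t) ^ β) := by ring
      _ = Real.sqrt M * C * (T - t) ^ (β - α / 2) := by
          rw [← Real.rpow_add hTt]; ring_nf
  have h3 := add_le_add h1 (mul_le_mul_of_nonneg_left h2 (by norm_num : (0:ℝ) ≤ 2))
  simpa only [hF] using h3

/-- **Trade-off law, `eLpNorm` form** (the conclusion shape of the former stub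
`stub_typeIIEnergyEquality`). [folklore] -/
theorem tendsto_eLpNorm_sub_of_enstrophyRate_of_l4Tail {ν T : ℝ} (hν : 0 < ν) (hT : 0 < T)
    {u : ℝ → EuclideanSpace ℝ (Fin 3) → EuclideanSpace ℝ (Fin 3)} {p : ℝ → EuclideanSpace ℝ (Fin 3) → ℝ}
    (hcl : IsClassicalNSSolutionOn (Ico 0 T) ν 0 u p) (hLH : IsLerayHopfOn T ν 0 (u 0) u)
    (hdec : HasRapidSpatialDecay (u 0)) {M α C β : ℝ} (hM : 0 ≤ M) (hα : α < 1) (hC : 0 ≤ C)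
    (hβ : α / 2 < β)
    (hZ : ∀ᶠ t in 𝓝[<] T, ∫ x, frobeniusNormSq (fderiv ℝ (u t) x) ≤ M * (T - t) ^ (-α))
    (htail : ∀ᶠ t in 𝓝[<] T, ∫⁻ τ in Ioo t T, ENNReal.ofReal (Real.sqrt (∫ x, ‖u τ x‖ ^ 4)) ≤
      ENNReal.ofReal (C * (T - t) ^ β)) :
    Tendsto (fun t => eLpNorm (u t - u T) 2 volume) (𝓝[<] T) (𝓝 0) :=
  (tendsto_eLpNorm_sub_iff_tendsto_integral_norm_sub_sq hT hLH).2
    (tendsto_integral_norm_sub_sq_of_enstrophyRate_of_l4Tail hν hT hcl hLH hdec hM hα hC hβ hZ htail)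

/-! ### Summary position: stub 3 lives at first blow-ups that are heavy in every sense -/

/-- **`TypeIIEnergyEquality ⟺ EnergyEqualityAtAllHeavyBlowup`.** The former stub 3 statement of
`Cruxes/NoTerminalJolt/Lines/regular_split.lean` (⟺ `stub_noFastEnergyConcentration` = stmt-18118,
rev 7) is equivalent to the same statement restricted to first blow-ups which are simultaneously
(a) NOT sup-norm Type I (the hypothesis `¬ IsTypeIBlowup`), (b) ENSTROPHY-HEAVY: for no `M ≥ 0`,
`0 < α < 4/5` does `∫|Du(t)|²_F ≤ M(T−t)^{−α}` hold near `T` (rev 5, p641804), and (c) `L⁴`-HEAVY: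
for no `M` does `∫‖u(t)‖⁴ ≤ M/(T−t)` hold near `T` (rev 8, p653319). Both sides OPEN; nothing is
asserted about them. [folklore] -/
theorem typeIIEnergyEquality_iff_allHeavy :
    (∀ (ν T : ℝ), 0 < ν → 0 < T →
      ∀ (u : ℝ → EuclideanSpace ℝ (Fin 3) → EuclideanSpace ℝ (Fin 3))
        (p : ℝ → EuclideanSpace ℝ (Fin 3) → ℝ),
        Literature.Analysis.FluidPDE.IsMaximalSmoothSolution ν 0 u p T →
        Literature.Analysis.FluidPDE.IsLerayHopfOn T ν 0 (u 0) u →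
        Literature.Analysis.FluidPDE.HasRapidSpatialDecay (u 0) →
        ¬ Literature.Analysis.FluidPDE.IsTypeIBlowup u T →
        Filter.Tendsto (fun t => MeasureTheory.eLpNorm (u t - u T) 2 MeasureTheory.volume)
          (nhdsWithin T (Set.Iio T)) (nhds 0)) ↔
    (∀ (ν T : ℝ), 0 < ν → 0 < T →
      ∀ (u : ℝ → EuclideanSpace ℝ (Fin 3) → EuclideanSpace ℝ (Fin 3))
        (p : ℝ → EuclideanSpace ℝ (Fin 3) → ℝ),
        Literature.Analysis.FluidPDE.IsMaximalSmoothSolution ν 0 u p T →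
        Literature.Analysis.FluidPDE.IsLerayHopfOn T ν 0 (u 0) u →
        Literature.Analysis.FluidPDE.HasRapidSpatialDecay (u 0) →
        ¬ Literature.Analysis.FluidPDE.IsTypeIBlowup u T →
        (∀ M α : ℝ, 0 ≤ M → 0 < α → α < 4 / 5 →
          ¬ ∀ᶠ t in nhdsWithin T (Set.Iio T),
            ∫ x, frobeniusNormSq (fderiv ℝ (u t) x) ≤ M * (T - t) ^ (-α)) →
        (∀ M : ℝ, ¬ ∀ᶠ t in nhdsWithin T (Set.Iio T), ∫ x, ‖u t x‖ ^ 4 ≤ M / (T - t)) →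
        Filter.Tendsto (fun t => MeasureTheory.eLpNorm (u t - u T) 2 MeasureTheory.volume)
          (nhdsWithin T (Set.Iio T)) (nhds 0)) := by
  refine ⟨fun h ν T hν hT u p hmax hLH hdec hnI _ _ => h ν T hν hT u p hmax hLH hdec hnI,
    fun h ν T hν hT u p hmax hLH hdec hnI => ?_⟩
  by_cases hmild : ∃ M α : ℝ, 0 ≤ M ∧ 0 < α ∧ α < 4 / 5 ∧
      ∀ᶠ t in nhdsWithin T (Set.Iio T), ∫ x, frobeniusNormSq (fderiv ℝ (u t) x) ≤ M * (T - t) ^ (-α)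
  · obtain ⟨M, α, hM, hα0, hα, hrate⟩ := hmild
    exact tendsto_eLpNorm_sub_of_enstrophyRate hν hT hmax.1 hLH hdec hM hα0 hα hrate
  by_cases hl4 : ∃ M : ℝ, ∀ᶠ t in nhdsWithin T (Set.Iio T), ∫ x, ‖u t x‖ ^ 4 ≤ M / (T - t)
  · obtain ⟨M, hrate⟩ := hl4
    exact tendsto_eLpNorm_sub_of_weakL4Rate hν hT hmax.1 hLH hdec hrate
  · exact h ν T hν hT u p hmax hLH hdec hnI
      (fun M α hM hα0 hα hev => hmild ⟨M, α, hM, hα0, hα, hev⟩)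
      (fun M hev => hl4 ⟨M, hev⟩)

end NoTerminalJolt

end Summit.NavierStokesRegularity.NavierStokesRegularity.Theorems

end
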